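import Literature.AlgebraicGeometry.GroupSchemes.StrictBirationalGroupLaw
import HarnessLib

/-!
# Dense sections transport along a morphism with fibrewise-dense image
# (Artin, *Néron models* §2, the stage `V′ ⊇ X`: sections of `X` through every open of `V′`)

Topic `Literature/AlgebraicGeometry/GroupSchemes`, namespace `Literature.AlgebraicGeometry.GroupSchemes`.
THEOREMS ONLY (no def, no named fact, no instance, no `sorry`).  Cell `hodgecm-mathlib` (D-0151), road W, sub-line
`koizumi_strictly_local`, node (G4a) (A-p14): the «sections of `𝒳` are dense ⇒ sections of the stage `𝒱` are dense»
bookkeeping, in the shape `HasDenseSections` of the W1 head (A-p06 probe v4 :250 / v6 :34, INLINED here because the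
shorthand lives in the crux workfile): for every point `y` of `𝒱` and every open `Ω ∋ y` there is a section of `𝒱 → S`
meeting `Ω` inside the fibre of `y`.

Proof (point-set): the fibre of `𝒱 → S` through `y` meets `Ω` at `y`; the image of `j : 𝒳 → 𝒱` is dense in that
fibre, so `Ω` contains some `j x` of the same fibre; a section `a` of `𝒳` through `j⁻¹ Ω` in the fibre of `x` gives the
section `a ≫ j` of `𝒱`.  No open-immersion, irreducibility or smoothness hypothesis is needed — only that `j` is a
morphism over `S` with fibrewise-dense image.  HC_CM is not proved here (banked Néron capital, no floor change).

## References
* [Artin1986NeronModels] M. Artin, *Néron models*, in *Arithmetic Geometry* (Cornell–Silverman), Springer 1986, §2 p. 221–223.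
* [EdixhovenRomagny] B. Edixhoven, M. Romagny, *Group schemes out of birational group laws, Néron models*, §3.
-/

noncomputable section

universe u

namespace Literature.AlgebraicGeometry.GroupSchemes

open CategoryTheory CategoryTheory.Limits _root_.AlgebraicGeometry

/-- **Dense sections pass to a stage.**  Let `j : 𝒳 ⟶ 𝒱` be a morphism of `S`-schemes whose image is dense in every
fibre of `𝒱 → S`.  If through every point `x` of `𝒳` and every open `Ω ∋ x` there is a section of `𝒳 → S` meeting `Ω`
in the fibre of `x` (the hypothesis `HasDenseSections 𝒳` of the road-W head, inlined), then the same holds for `𝒱`: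
the sections `a ≫ j.left` do it.  [cite: Artin1986NeronModels, §2 (2.3)–(2.5) p. 221–223] -/
theorem forall_exists_section_mem_of_isFibrewiseDense_range {S : Scheme.{u}} {𝒳 𝒱 : Over S} (j : 𝒳 ⟶ 𝒱)
    (hj : IsFibrewiseDense 𝒱.hom (Set.range j.left.base))
    (h𝒳 : ∀ (x : 𝒳.left) (Ω : 𝒳.left.Opens), x ∈ Ω →
      ∃ a : S ⟶ 𝒳.left, a ≫ 𝒳.hom = 𝟙 S ∧ ∃ s : S, a.base s ∈ Ω ∧ 𝒳.hom.base (a.base s) = 𝒳.hom.base x) :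
    ∀ (y : 𝒱.left) (Ω : 𝒱.left.Opens), y ∈ Ω →
      ∃ a : S ⟶ 𝒱.left, a ≫ 𝒱.hom = 𝟙 S ∧ ∃ s : S, a.base s ∈ Ω ∧ 𝒱.hom.base (a.base s) = 𝒱.hom.base y := by
  intro y Ω hy
  -- the fibre of `𝒱 → S` through `y` meets `Ω` at `y`, hence meets `Ω ∩ range j`
  have hcl : y ∈ closure (Set.range j.left.base ∩ 𝒱.hom.base ⁻¹' {𝒱.hom.base y}) :=
    hj (𝒱.hom.base y) (by simp)
  obtain ⟨y', hy'Ω, ⟨x, rfl⟩, hy'fib⟩ := mem_closure_iff.mp hcl Ω Ω.isOpen hy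
  -- a section of `𝒳` through `j⁻¹ Ω` in the fibre of `x`
  have hxΩ : x ∈ j.left ⁻¹ᵁ Ω := hy'Ω
  obtain ⟨a, ha, s, hsΩ, hsfib⟩ := h𝒳 x (j.left ⁻¹ᵁ Ω) hxΩ
  refine ⟨a ≫ j.left, ?_, s, ?_, ?_⟩
  · rw [Category.assoc, Over.w j]
    exact ha
  · exact hsΩ
  · have hw : ∀ z : 𝒳.left, 𝒱.hom.base (j.left.base z) = 𝒳.hom.base z := fun z => by
      rw [← Scheme.Hom.comp_apply, Over.w j]
    rw [Scheme.Hom.comp_apply, hw, hsfib, ← hw]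
    exact hy'fib

end Literature.AlgebraicGeometry.GroupSchemes
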